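import Mathlib
import HarnessLib
import Summits.ResolutionOfSingularities.ResolutionOfSingularities.Theorems.WildQuotientsWildQuotientResolutionS1aKillTouch
import Summits.ResolutionOfSingularities.ResolutionOfSingularities.Theorems.WildQuotientsWildQuotientResolutionS1aExtendRees
import Summits.ResolutionOfSingularities.ResolutionOfSingularities.Theorems.WildQuotientsWildQuotientResolutionS1aChartStable

/-!
# S1a — GLUING COMPATIBLE LOCAL KILLS ALONG ONE COMPONENT: `KillAgreeReach p ⇒ KillTouchReach p` (the next cut of the K stub)

[OURS · L1 W4.5c · lead-1 g9; plan-1 g12 RULING 09:40:43Z (1c)/(3): «the remaining content of K is GLOBALISATION ALONG ONE COMPONENT … several affine kill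
charts must AGREE on overlaps — TYPE that hypothesis as an explicit research def (one-component local agreement) and prove K-touch from it»] — NOT
statements of the manuscript; counted 0; AI-level work, weaker than expert review. Crux stmt-ResolutionOfSingularities-17941, line `s1a-logminvertex` v9,
registered research stub `stub_killTouchReach`. Route-independent.

THE GLUING. On a separated locally Noetherian `G`-scheme, let `(Oᵢ, 𝒦ᵢ)` be finitely many PRINCIPAL-CENTRE CHARTS of one degree `d` whose filtrations AGREE
on every affine open inside `Oᵢ ∩ Oₖ`. Put `Lᵢ := pushforwardRees (pullbackRees 𝒦ᵢ Oᵢ.ι) Oᵢ.ι` (restrict to the chart, extend by the unit filtration — the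
LARGEST filtration agreeing with `𝒦ᵢ` on `Oᵢ`) and `J := infRees L` (intersection).
* `localRees`, `filtration_le_filtration_localRees` (★ the key inequality: `𝒦ᵢ(Oᵢ) ≤ Lₖ(Oᵢ)` — by agreement on `Oᵢ ∩ Oₖ`, affine since the scheme is
  separated; Mathlib `IdealSheafData.ideal_map` + the treeʼs `ideal_comap_of_le`), `filtration_localRees_le` (`Lᵢ(Oᵢ) ≤ 𝒦ᵢ(Oᵢ)`, `comap_map_le`);
* ★ `filtration_glue_eq` — `J` restricts to `𝒦ᵢ` on `Oᵢ`; `comap_aut_glue` — `J` is `G`-stable (each `Lᵢ` is: `comap_restrict_aut_pullbackRees` p611561 +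
  `comap_aut_pushforwardRees` p615490 + `comap_aut_infRees` p612813); `support_glue_subset` — `supp J_d ⊆ ⋃ᵢ closure (supp (𝒦ᵢ)_d ∩ Oᵢ)`;
* ★★ `exists_isPrincipalCentre_of_agree` (model form): if moreover the charts cover a CLOSED `B ⊆ badLocus` and `supp (𝒦ᵢ)_d ∩ Oᵢ ⊆ B` ((K3)), then `J` is
  a PRINCIPAL CENTRE with `B ⊆ supp J_d ⊆ B` (G1 puts the bad points of a principal chart into the support; idle node charts off `B`);
* research def **`KillAgreeReach p`** (OURS CANDIDATE, asserted nowhere: at every reachable all-killable model, SOME non-empty closed `B ⊆ badLocus` is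
  covered by finitely many principal kill charts of one degree with supports inside `B` on the charts and AGREEING on overlaps) and
  ★★ `killTouchReach_of_killAgreeReach : KillAgreeReach p → KillTouchReach p`; `isSeparated_of_datum` (models of a datum are separated schemes).
So after this file the K stub reads: LOCAL AGREEMENT of the kill charts along one component (TWISTED-INVARIANT-DESIGN v1 CC-U/CC-S restricted to one
component) + (K3). No statement about the canonical valuation is typed here (L-OBJ).
-/

set_option linter.dupNamespace false

noncomputable section

universe u

open CategoryTheory Limits AlgebraicGeometry TopologicalSpace Topology Opposite
open Literature.AlgebraicGeometry.Resolution Literature.AlgebraicGeometry.RelativeSpec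
open Summit.ResolutionOfSingularities.ResolutionOfSingularities.Theorems.WildQuotientResolution.S1
open Summit.ResolutionOfSingularities.ResolutionOfSingularities.Theorems.WildQuotientResolution.S1.NodeAtlas
open Summit.ResolutionOfSingularities.ResolutionOfSingularities.Theorems.WildQuotientResolution.S1.BlowupCharts
open Summit.ResolutionOfSingularities.ResolutionOfSingularities.Theorems.WildQuotientResolution.S1.G1Proof
open Summit.ResolutionOfSingularities.ResolutionOfSingularities.Theorems.WildQuotientResolution.S1.KillFamily
open Summit.ResolutionOfSingularities.ResolutionOfSingularities.Theorems.WildQuotientResolution.S1.KillClopen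
open Summit.ResolutionOfSingularities.ResolutionOfSingularities.Theorems.WildQuotientResolution.S1.CentreGluing
open Summit.ResolutionOfSingularities.ResolutionOfSingularities.Theorems.WildQuotientResolution.S1.KillableTransport
open Summit.ResolutionOfSingularities.ResolutionOfSingularities.Theorems.WildQuotientResolution.S1.ExtendRees
open Summit.ResolutionOfSingularities.ResolutionOfSingularities.Theorems.WildQuotientResolution.S1.ChartStable
open Summit.ResolutionOfSingularities.ResolutionOfSingularities.Theorems.WildQuotientResolution.S1.NodeChartAway

namespace Summit.ResolutionOfSingularities.ResolutionOfSingularities.Theorems.WildQuotientResolution.S1.KillGlue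

/-! ## The local filtration of a chart: restrict, then extend by the unit filtration -/

section Local

variable {V : Scheme.{u}}

/-- **`localRees 𝒦 O`** := `pushforwardRees (pullbackRees 𝒦 O.ι) O.ι` — the largest Rees filtration agreeing with `𝒦` on the open `O`
(unit away from the closure of `supp 𝒦 ∩ O`). [OURS · L1 W4.5c] -/
def localRees (𝒦 : ReesFiltration V) (O : V.Opens) : ReesFiltration V :=
  pushforwardRees (pullbackRees 𝒦 O.ι) O.ι

/-- Pieces of the local filtration. -/
theorem localRees_ideal (𝒦 : ReesFiltration V) (O : V.Opens) (n : ℕ) :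
    (localRees 𝒦 O).ideal n = ((𝒦.ideal n).comap O.ι).map O.ι := rfl

variable [IsLocallyNoetherian V]

/-- The support of a piece of the local filtration is the closure of `supp 𝒦ₙ ∩ O`. -/
theorem support_localRees (𝒦 : ReesFiltration V) (O : V.Opens) (n : ℕ) :
    (((localRees 𝒦 O).ideal n).support : Set V) = closure (((𝒦.ideal n).support : Set V) ∩ O) := by
  rw [localRees, support_pushforwardRees, pullbackRees_ideal, Scheme.IdealSheafData.support_comap]
  congr 1
  ext x
  simp only [TopologicalSpace.Closeds.coe_preimage, Set.mem_image, Set.mem_preimage, Set.mem_inter_iff]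
  constructor
  · rintro ⟨y, hy, rfl⟩
    exact ⟨hy, y.2⟩
  · rintro ⟨hx, hxO⟩
    exact ⟨⟨x, hxO⟩, hx, rfl⟩

omit [IsLocallyNoetherian V] in
/-- **`Lᵢ(Oᵢ) ≤ 𝒦ᵢ(Oᵢ)`**: on its own chart the local filtration is below the original one (`comap_map_le`). -/
theorem filtration_localRees_le (𝒦 : ReesFiltration V) (O : V.Opens) (hO : IsAffineOpen O) (n : ℕ) :
    ((localRees 𝒦 O).filtration ⟨O, hO⟩).ideal n ≤ (𝒦.filtration ⟨O, hO⟩).ideal n := by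
  rw [ReesFiltration.filtration_ideal, ReesFiltration.filtration_ideal, localRees_ideal]
  -- compare after pulling back to the scheme `↑O`
  have hle : (((𝒦.ideal n).comap O.ι).map O.ι).comap O.ι ≤ (𝒦.ideal n).comap O.ι := Scheme.IdealSheafData.comap_map_le _ _
  haveI : IsAffine (O : Scheme.{u}) := hO
  have hOtop : IsAffineOpen (O.ι ⁻¹ᵁ O) := by rw [Scheme.Opens.ι_preimage_self]; exact isAffineOpen_top _
  let Otop : (O : Scheme.{u}).affineOpens := ⟨O.ι ⁻¹ᵁ O, hOtop⟩
  have h1 := hle Otop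
  rw [ideal_comap_of_le O.ι _ ⟨O, hO⟩ Otop le_rfl, ideal_comap_of_le O.ι _ ⟨O, hO⟩ Otop le_rfl] at h1
  haveI : IsIso (O.ι.appLE O (O.ι ⁻¹ᵁ O) le_rfl) := isIso_ι_appLE O
  let φ : Γ(V, O) ≃+* Γ(O, O.ι ⁻¹ᵁ O) := (asIso (O.ι.appLE O (O.ι ⁻¹ᵁ O) le_rfl)).commRingCatIsoToRingEquiv
  have hφ : (O.ι.appLE O (O.ι ⁻¹ᵁ O) le_rfl).hom = (φ : Γ(V, O) →+* Γ(O, O.ι ⁻¹ᵁ O)) := rfl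
  rw [hφ] at h1
  calc (((𝒦.ideal n).comap O.ι).map O.ι).ideal ⟨O, hO⟩
      ≤ ((((( 𝒦.ideal n).comap O.ι).map O.ι).ideal ⟨O, hO⟩).map (φ : Γ(V, O) →+* Γ(O, O.ι ⁻¹ᵁ O))).comap
          (φ : Γ(V, O) →+* Γ(O, O.ι ⁻¹ᵁ O)) := Ideal.le_comap_map
    _ ≤ ((((𝒦.ideal n).ideal ⟨O, hO⟩).map (φ : Γ(V, O) →+* Γ(O, O.ι ⁻¹ᵁ O)))).comap (φ : Γ(V, O) →+* Γ(O, O.ι ⁻¹ᵁ O)) :=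
          Ideal.comap_mono h1
    _ = (𝒦.ideal n).ideal ⟨O, hO⟩ := Ideal.comap_map_of_bijective _ φ.bijective

end Local

/-! ## The key inequality: `𝒦ᵢ(Oᵢ) ≤ Lₖ(Oᵢ)` from agreement on `Oᵢ ∩ Oₖ` -/

section Key

variable {V : Scheme.{u}} [IsLocallyNoetherian V] [V.IsSeparated]

/-- ★ **THE KEY INEQUALITY**: if `𝒦ᵢ` and `𝒦ₖ` agree on every affine open inside `Oᵢ ∩ Oₖ` (affine opens, separated scheme), then on `Oᵢ` the
filtration `𝒦ᵢ` lies below the local filtration `localRees 𝒦ₖ Oₖ`. [OURS · L1 W4.5c] -/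
theorem filtration_le_filtration_localRees (𝒦i 𝒦k : ReesFiltration V) (Oi Ok : V.Opens) (hOi : IsAffineOpen Oi) (hOk : IsAffineOpen Ok)
    (hagree : ∀ (U : V.affineOpens), U.1 ≤ Oi → U.1 ≤ Ok → ∀ n, ((𝒦i.filtration U).ideal n) = ((𝒦k.filtration U).ideal n)) (n : ℕ) :
    (𝒦i.filtration ⟨Oi, hOi⟩).ideal n ≤ ((localRees 𝒦k Ok).filtration ⟨Oi, hOi⟩).ideal n := by
  let j : (Ok : Scheme.{u}) ⟶ V := Ok.ι
  -- the overlap and its preimage in `↑Ok` are affine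
  have hW : IsAffineOpen (Oi ⊓ Ok) := hOi.inf hOk
  let W : V.affineOpens := ⟨Oi ⊓ Ok, hW⟩
  have hpre : j ⁻¹ᵁ Oi = j ⁻¹ᵁ (Oi ⊓ Ok) := by
    rw [Scheme.Hom.preimage_inf]
    change _ = j ⁻¹ᵁ Oi ⊓ Ok.ι ⁻¹ᵁ Ok
    rw [Scheme.Opens.ι_preimage_self, inf_top_eq]
  have H : IsAffineOpen (j ⁻¹ᵁ Oi) := by
    rw [hpre, ← j.isAffineOpen_iff_of_isOpenImmersion, Scheme.Hom.image_preimage_eq_opensRange_inf, Scheme.Opens.opensRange_ι,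
      inf_eq_right.mpr inf_le_right]
    exact hW
  have e : (j ⁻¹ᵁ Oi : (Ok : Scheme.{u}).Opens) ≤ j ⁻¹ᵁ W.1 := hpre.le
  intro s hs
  rw [ReesFiltration.filtration_ideal] at hs ⊢
  rw [localRees_ideal, Scheme.IdealSheafData.ideal_map _ j ⟨Oi, hOi⟩ H, Ideal.mem_comap,
    ideal_comap_of_le j (𝒦k.ideal n) W ⟨j ⁻¹ᵁ Oi, H⟩ e]
  -- agreement on the overlap
  have hWk : (𝒦k.ideal n).ideal W = (𝒦i.ideal n).ideal W := by
    have := hagree W inf_le_left inf_le_right n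
    rw [ReesFiltration.filtration_ideal, ReesFiltration.filtration_ideal] at this
    exact this.symm
  rw [hWk]
  -- `j.app Oi = res_{Oi → W} ≫ j.appLE W (j⁻¹ Oi)`
  have hres : (j.app Oi).hom s = (j.appLE W.1 (j ⁻¹ᵁ Oi) e).hom ((V.presheaf.map (homOfLE (inf_le_left : W.1 ≤ Oi)).op).hom s) := by
    have h := j.map_appLE e (homOfLE (inf_le_left : W.1 ≤ Oi)).op
    rw [Scheme.Hom.app_eq_appLE]
    exact (congrArg (fun φ : Γ(V, Oi) ⟶ Γ(Ok, j ⁻¹ᵁ Oi) => φ s) h).symm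
  rw [hres]
  refine Ideal.mem_map_of_mem _ ?_
  exact Scheme.IdealSheafData.ideal_le_comap_ideal (𝒦i.ideal n) (U := W) (V := ⟨Oi, hOi⟩) (inf_le_left : Oi ⊓ Ok ≤ Oi) hs

end Key

/-! ## The glued filtration -/

section Glue

variable {p : ℕ} {V Y : Scheme.{u}} {q : V ⟶ Y} {G : Type u} [Group G] (ρ : ActionOver q G) (g₀ : G)
variable [IsLocallyNoetherian V] [V.IsSeparated] {ι : Type} [Finite ι]

/-- **The glued filtration** `J := ⨅ᵢ localRees 𝒦ᵢ Oᵢ`. [OURS · L1 W4.5c] -/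
def glue (O : ι → ρ.StableAffineOpens) (𝒦 : ι → ReesFiltration V) : ReesFiltration V :=
  infRees fun i => localRees (𝒦 i) (O i).1

variable {ρ g₀}

/-- ★ **The glued filtration restricts to `𝒦ᵢ` on the chart `Oᵢ`** (agreement on overlaps). [OURS · L1 W4.5c] -/
theorem filtration_glue_eq (O : ι → ρ.StableAffineOpens) (𝒦 : ι → ReesFiltration V) (hO : ∀ i, IsAffineOpen (O i).1)
    (hagree : ∀ i k (U : V.affineOpens), U.1 ≤ (O i).1 → U.1 ≤ (O k).1 → ∀ n, ((𝒦 i).filtration U).ideal n = ((𝒦 k).filtration U).ideal n)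
    (i : ι) (n : ℕ) : ((glue ρ O 𝒦).filtration ⟨(O i).1, hO i⟩).ideal n = ((𝒦 i).filtration ⟨(O i).1, hO i⟩).ideal n := by
  rw [glue, filtration_infRees]
  apply le_antisymm
  · exact (iInf_le _ i).trans (filtration_localRees_le (𝒦 i) (O i).1 (hO i) n)
  · exact le_iInf fun k => filtration_le_filtration_localRees (𝒦 i) (𝒦 k) (O i).1 (O k).1 (hO i) (hO k) (hagree i k) n

omit [V.IsSeparated] in
/-- **The glued filtration is `G`-stable** when every chart is a principal-centre chart (`G = ⟨g₀⟩` finite). [OURS · L1 W4.5c] -/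
theorem comap_aut_glue [Finite G] (hG : ∀ g : G, g ∈ Subgroup.zpowers g₀) (O : ι → ρ.StableAffineOpens) (𝒦 : ι → ReesFiltration V) {d : ℕ}
    (hprin : ∀ i, IsPrincipalCentreChart p ρ g₀ (𝒦 i) d (O i)) (g : G) (n : ℕ) :
    ((glue ρ O 𝒦).ideal n).comap (ρ.aut g).hom = (glue ρ O 𝒦).ideal n := by
  refine comap_aut_infRees ρ _ (fun i g n => ?_) g n
  have hcomm : ∀ g : G, ((ρ.restrict (O i).1 (O i).2.1).aut g).hom ≫ (O i).1.ι = (O i).1.ι ≫ (ρ.aut g).hom := fun g => by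
    rw [ActionOver.restrict_aut_hom, ActionOver.restrictHom_ι]
  exact comap_aut_pushforwardRees ρ (ρ.restrict (O i).1 (O i).2.1) (O i).1.ι hcomm (pullbackRees (𝒦 i) (O i).1.ι)
    (fun g n => comap_restrict_aut_pullbackRees ρ (O i) hG (hprin i) (hprin i).1 g n) g n

/-- Support of a finite product of ideal sheaves (as a set). -/
theorem coe_support_finsetProd {X : Scheme.{u}} {κ : Type*} (s : Finset κ) (I : κ → X.IdealSheafData) :
    (((∏ i ∈ s, I i).support : Closeds X) : Set X) = ⋃ i ∈ s, (((I i).support : Closeds X) : Set X) := by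
  classical
  induction s using Finset.induction_on with
  | empty =>
    rw [Finset.prod_empty]
    change (((⊤ : X.IdealSheafData).support : Closeds X) : Set X) = _
    rw [Scheme.IdealSheafData.support_top]
    simp
  | insert a s ha ih =>
    rw [Finset.prod_insert ha, Scheme.IdealSheafData.support_mul, TopologicalSpace.Closeds.coe_sup, ih, Finset.set_biUnion_insert]

/-- Support of a finite intersection of ideal sheaves ⊆ union of the supports (the product lies below the intersection). -/
theorem coe_support_iInf_subset {X : Scheme.{u}} {κ : Type*} [Fintype κ] (I : κ → X.IdealSheafData) :
    (((⨅ i, I i).support : Closeds X) : Set X) ⊆ ⋃ i, (((I i).support : Closeds X) : Set X) := by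
  classical
  have hle : ∏ i, I i ≤ ⨅ i, I i := le_iInf fun j => by
    rw [← Finset.mul_prod_erase Finset.univ I (Finset.mem_univ j)]
    have h1 : (∏ i ∈ Finset.univ.erase j, I i) ≤ 1 := le_top
    calc I j * ∏ i ∈ Finset.univ.erase j, I i ≤ I j * 1 := mul_le_mul_of_nonneg_left h1 bot_le
      _ = I j := mul_one _
  have h2 : (((⨅ i, I i).support : Closeds X) : Set X) ⊆ (((∏ i, I i).support : Closeds X) : Set X) :=
    Scheme.IdealSheafData.support_antitone hle
  refine h2.trans ?_
  rw [coe_support_finsetProd]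
  exact Set.iUnion₂_subset fun i _ => Set.subset_iUnion (fun i => (((I i).support : Closeds X) : Set X)) i

omit [V.IsSeparated] in
/-- **Support of the glued filtration** ⊆ the union of the closures of the chart supports. [OURS · L1 W4.5c] -/
theorem support_glue_subset (O : ι → ρ.StableAffineOpens) (𝒦 : ι → ReesFiltration V) (n : ℕ) :
    (((glue ρ O 𝒦).ideal n).support : Set V) ⊆ ⋃ i, closure ((((𝒦 i).ideal n).support : Set V) ∩ (O i).1) := by
  haveI : Fintype ι := Fintype.ofFinite ι
  rw [glue, infRees_ideal]
  refine (coe_support_iInf_subset _).trans (Set.iUnion_mono fun i => ?_)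
  rw [support_localRees]

end Glue

/-! ## Model form: a principal centre from agreeing kill charts along a closed part of the bad locus -/

section Model

variable {p : ℕ} {X' X₁ : Scheme.{0}} {q : X' ⟶ X₁} {G : Type} [Group G] {ρ : G →* Aut X'} {g₀ : G}

/-- ★★ **AGREEING PRINCIPAL KILL CHARTS ALONG A CLOSED `B ⊆ Z(M)` GLUE TO A PRINCIPAL CENTRE WITH SUPPORT `B`.** On a model over a Noetherian base with
separated underlying scheme (`G = ⟨g₀⟩` finite, `p` prime): finitely many principal-centre charts `(Oᵢ, 𝒦ᵢ)` of one degree `d > 0` covering a closed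
`B ⊆ badLocus`, with `supp (𝒦ᵢ)_d ∩ Oᵢ ⊆ B` ((K3)) and filtrations AGREEING on every affine open inside `Oᵢ ∩ Oₖ` ((K1)), give a PRINCIPAL CENTRE `J`
(the glued filtration) with `supp J_d = B`. [OURS · L1 W4.5c] -/
theorem exists_isPrincipalCentre_of_agree [Finite G] (hp : p.Prime) (hG : ∀ g : G, g ∈ Subgroup.zpowers g₀) (M : GameFrame.GModel p q G ρ g₀)
    (hB : M.HasNoetherianBase) [M.V.IsSeparated] {ι : Type} [Finite ι]
    (O : ι → M.act.StableAffineOpens) (𝒦 : ι → ReesFiltration M.V) {d : ℕ} (hd : 0 < d)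
    (hprin : ∀ i, IsPrincipalCentreChart p M.act g₀ (𝒦 i) d (O i))
    (hagree : ∀ i k (U : M.V.affineOpens), U.1 ≤ (O i).1 → U.1 ≤ (O k).1 → ∀ n, ((𝒦 i).filtration U).ideal n = ((𝒦 k).filtration U).ideal n)
    {B : Set M.V} (hBc : IsClosed B) (hBbad : B ⊆ M.badLocus) (hBcov : B ⊆ ⋃ i, ((O i).1 : Set M.V))
    (hsupp : ∀ i, (((𝒦 i).ideal d).support : Set M.V) ∩ (O i).1 ⊆ B) :
    ∃ J : ReesFiltration M.V, IsPrincipalCentre p M.act g₀ J d ∧ (((J.ideal d).support : Set M.V) = B) ∧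
      ∀ i, IsPrincipalCentreChart p M.act g₀ J d (O i) := by
  haveI : IsLocallyNoetherian M.V := M.isLocallyNoetherian
  let J : ReesFiltration M.V := glue M.act O 𝒦
  have hJO : ∀ i, IsPrincipalCentreChart p M.act g₀ J d (O i) := fun i =>
    isPrincipalCentreChart_congr (hprin i) fun hO n => filtration_glue_eq O 𝒦 (fun i => (hprin i).1) hagree i n
  have hGst : ∀ (g : G) (n : ℕ), (J.ideal n).comap (M.act.aut g).hom = J.ideal n := comap_aut_glue hG O 𝒦 hprin
  -- support `⊆ B`
  have hsub : ((J.ideal d).support : Set M.V) ⊆ B := by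
    refine (support_glue_subset (ρ := M.act) O 𝒦 d).trans (Set.iUnion_subset fun i => ?_)
    exact closure_minimal (hsupp i) hBc
  -- support `⊇ B` (G1 on the charts `Oᵢ` of `J`)
  have hsup : B ⊆ ((J.ideal d).support : Set M.V) := fun v hv => by
    obtain ⟨i, hvi⟩ := Set.mem_iUnion.mp (hBcov hv)
    exact g1 hp q G ρ g₀ hG M J d (O i) hB (hJO i) v hvi (hBbad hv)
  refine ⟨J, ⟨hd, hGst, fun v => ?_⟩, Set.Subset.antisymm hsub hsup, hJO⟩
  by_cases hv : v ∈ ((J.ideal d).support : Set M.V)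
  · obtain ⟨i, hvi⟩ := Set.mem_iUnion.mp (hBcov (hsub hv))
    exact ⟨O i, hvi, Or.inl (hJO i)⟩
  · -- off the support: an idle node chart
    obtain ⟨O₀, hvO₀, hn⟩ := M.atlas v
    obtain ⟨O'', hvO'', -, hO''W, hn''⟩ := exists_isNodeChart_le hn hvO₀ (J.ideal d).support.compl
      (preimage_support_compl M.act (fun g => hGst g d)) hv
    refine ⟨O'', hvO'', Or.inr ⟨hn'', fun n => filtration_eq_top_of_disjoint _ hd ⟨O''.1, hn''.1⟩ ?_ n⟩⟩
    rw [Set.disjoint_left]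
    intro x hx hx'
    exact hO''W hx hx'

/-- **Every model of a datum over a field is a SEPARATED scheme** (`V → X′` proper, `X′ → X₁` finite, `X₁ → Spec k` separated). -/
theorem isSeparated_of_datum {k : Type} [Field k] (f : X₁ ⟶ Spec (.of k)) [IsSeparated f] [IsFinite q] (M : GameFrame.GModel p q G ρ g₀) :
    M.V.IsSeparated := by
  haveI := M.isProper
  have hr : M.r = M.π ≫ q := M.r_eq
  haveI : IsSeparated q := IsSeparated.of_isAffineHom q
  haveI : IsSeparated M.r := by rw [hr]; infer_instance
  haveI : IsSeparated (terminal.from M.V) := by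
    rw [← terminal.comp_from (M.r ≫ f)]
    infer_instance
  exact ⟨‹_›⟩

end Model

/-! ## The K-side research statement in LOCAL-AGREEMENT form, and `KillAgreeReach ⇒ KillTouchReach` -/

/-- **`KillAgreeReach p`** (OURS CANDIDATE research statement, asserted nowhere; the K side as LOCAL AGREEMENT ALONG ONE COMPONENT, plan-1 g12 ruling
2026-08-28T09:40:43Z (1c)): at every non-terminal model reachable from the initial model of a crux datum with every bad point killable (`jInf = ⊥`), there
are a NON-EMPTY CLOSED `B ⊆ badLocus` (intended: one connected component, or the `G`-orbit of one) and finitely many PRINCIPAL-CENTRE CHARTS `(Oᵢ, 𝒦ᵢ)` of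
one Veronese degree `d > 0` covering `B`, whose supports lie inside `B` on their charts ((K3): `supp (𝒦ᵢ)_d ∩ Oᵢ ⊆ B`) and whose filtrations AGREE on
every affine open inside `Oᵢ ∩ Oₖ` ((K1) = the local uniqueness CC-U/CC-S of TWISTED-INVARIANT-DESIGN v1 restricted to one component). By
`exists_isPrincipalCentre_of_agree` they glue to ONE principal centre with support `B`, so `KillTouchReach p` follows. EVIDENCE: dim 4 only (census F-CAN
66/66: the LP-minimal local kill is the same germ at every node of a component; F-CCU (census v7): frame-independence up to adaptedness). WHY IT MIGHT
FAIL: two different LP-optimal kills at one point; special points of `B` needing other weights than generic points. [OURS · L1 W4.5c] -/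
def KillAgreeReach (p : ℕ) : Prop :=
  ∀ (k : Type) [Field k] [CharP k p] [PerfectField k] (X' X₁ : Scheme.{0})
    (f : X₁ ⟶ Spec (.of k)) (q : X' ⟶ X₁) (G : Type) [Group G] [Finite G]
    (ρ : G →* Aut X'), Nat.card G = p → IsSeparated f → LocallyOfFiniteType f → QuasiCompact f →
    IsIntegral X₁ → ∀ [IsIntegral X'], Scheme.IsRegular X' → IsFinite q → Function.Surjective q.base →
    (∃ U : X₁.Opens, Dense (U : Set X₁) ∧ Etale (q ∣_ U)) →
    ∀ (hq : ∀ g : G, (ρ g).hom ≫ q = q),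
    (∀ x y : X', q.base x = q.base y → ∃ g : G, (ρ g).hom.base x = y) →
    topologicalKrullDim X₁ ≤ 4 → Function.Injective ρ →
    ∀ (g₀ : G), (∀ g : G, g ∈ Subgroup.zpowers g₀) → ∀ [IsLocallyNoetherian X']
      (h₀ : NodeAtlas p (⟨ρ, hq⟩ : ActionOver q G) g₀),
      ∀ M : GameFrame.GModel p q G ρ g₀, (GameFrame.GModel.initial hq h₀).Reachable M → ¬ M.Terminal → M.jInf = ⊥ →
        ∃ (B : Set M.V) (n : ℕ) (O : Fin n → M.act.StableAffineOpens) (𝒦 : Fin n → ReesFiltration M.V) (d : ℕ),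
          B.Nonempty ∧ IsClosed B ∧ B ⊆ M.badLocus ∧ (B ⊆ ⋃ i, ((O i).1 : Set M.V)) ∧ 0 < d ∧
          (∀ i, IsPrincipalCentreChart p M.act g₀ (𝒦 i) d (O i)) ∧
          (∀ i, (((𝒦 i).ideal d).support : Set M.V) ∩ (O i).1 ⊆ B) ∧
          (∀ i j (U : M.V.affineOpens), U.1 ≤ (O i).1 → U.1 ≤ (O j).1 →
            ∀ m, ((𝒦 i).filtration U).ideal m = ((𝒦 j).filtration U).ideal m)

/-- ★★ **LOCAL AGREEMENT ALONG ONE COMPONENT IMPLIES THE TOUCH FORM**: `KillAgreeReach p ⇒ KillTouchReach p`. [OURS · L1 W4.5c] -/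
theorem killTouchReach_of_killAgreeReach {p : ℕ} (hp : p.Prime) (h : KillAgreeReach p) : KillTouchReach p := by
  intro k _ _ _ X' X₁ f q G _ _ ρ hG hfs hfft hfqc hX₁ _ hreg hqfin hqs hqet hq horb hdim hinj g₀ hg₀ _ h₀ M hR hT hj
  haveI := hfs
  haveI := hfft
  haveI := hqfin
  haveI : M.V.IsSeparated := isSeparated_of_datum f M
  obtain ⟨B, n, O, 𝒦, d, hBne, hBc, hBbad, hBcov, hd, hprin, hsupp, hagree⟩ :=
    h k X' X₁ f q G ρ hG hfs hfft hfqc hX₁ hreg hqfin hqs hqet hq horb hdim hinj g₀ hg₀ h₀ M hR hT hj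
  obtain ⟨J, hJ, hJsupp, -⟩ := exists_isPrincipalCentre_of_agree hp hg₀ M (GameFrame.GModel.hasNoetherianBase_of_datum f M) O 𝒦 hd hprin
    hagree hBc hBbad hBcov hsupp
  obtain ⟨v, hv⟩ := hBne
  exact ⟨J, d, hJ, v, hBbad hv, hJsupp.symm ▸ hv⟩

end Summit.ResolutionOfSingularities.ResolutionOfSingularities.Theorems.WildQuotientResolution.S1.KillGlue

end
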